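import Mathlib.LinearAlgebra.Matrix.Determinant.Basic
import Mathlib.Topology.Instances.Matrix
import Mathlib.Algebra.Polynomial.Coeff
import Literature.Analysis.TotalPositivity.PolyaFrequency
import HarnessLib

/-!
# Closure properties of Pólya frequency sequences — proved

Trunk T-ANALYSIS (Literature/Analysis/TotalPositivity). Leaf L4 of the decomposition of
`Literature.NumberTheory.LFunctions.katkova_rh_iff_pf` (Katkova 2006, §1 Thm. C) / of
`Literature.Analysis.TotalPositivity.pf_taylor_iff_zeros_of_order_lt_one` (Karlin 1968, Ch. 8): the elementary
half of the Aissen–Schoenberg–Whitney theory, namely that the Taylor coefficients of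
`C ∏ᵢ (1 + αᵢ z)` (`C ≥ 0`, `αᵢ ≥ 0`) form a PF sequence, and that PF sequences are closed under
termwise limits [Aissen–Schoenberg–Whitney 1952, §1; Karlin 1968, Ch. 8, §1–§3].

* `IsPolyaFrequencySeq.smul` — `C ≥ 0`, `a` PF `⇒` `C • a` PF (an order-`k` minor scales by `C^k`).
* `isPolyaFrequencySeq_delta` — `(1, 0, 0, …)` is PF (minors of the identity are `0` or `1`).
* `IsPolyaFrequencySeq.mulLinear` — `a` PF, `α ≥ 0` `⇒` `(a_n + α a_{n-1})_n` PF, i.e. multiplying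
  the generating function by `1 + α z` preserves PF. Proof: column `j` of the new minor is
  column `c_j` plus `α ×` column `c_j + 1` of the Toeplitz matrix of `a`; expand multilinearly
  (`MultilinearMap.map_sum`); each term is `α^{#ε} ×` a minor of `a` with weakly increasing
  columns `c_j + ε_j`, which is `≥ 0` (PF) or has two equal columns (`= 0`).
* `isPolyaFrequencySeq_coeff_prod_linear` — the coefficient sequence of the real polynomial
  `C · ∏_{i < N} (1 + αᵢ X)` is PF.
* `IsPolyaFrequencySeq.of_tendsto` — a termwise limit of PF sequences is PF (minors are continuous).

## References

* M. Aissen, I. J. Schoenberg, A. M. Whitney, *On the generating functions of totally positive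
  sequences I*, J. Analyse Math. 2 (1952) 93–103, §1.
* S. Karlin, *Total Positivity I*, Stanford UP 1968, Ch. 8, §1–§3.
-/

noncomputable section

open scoped Topology
open Filter Polynomial

namespace Literature.Analysis.TotalPositivity

/-! ### Scaling -/

/-- `seqZ` commutes with scaling. [folklore] -/
theorem seqZ_const_mul (C : ℝ) (a : ℕ → ℝ) (n : ℤ) :
    seqZ (fun k => C * a k) n = C * seqZ a n := by
  unfold seqZ
  split_ifs <;> simp

/-- An order-`k` Toeplitz minor of `C • a` is `C^k` times that of `a`. [Karlin 1968, Ch. 8, §1] [folklore] -/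
theorem toeplitzMinor_const_mul (C : ℝ) (a : ℕ → ℝ) {k : ℕ} (r c : Fin k → ℕ) :
    toeplitzMinor (fun n => C * a n) r c = C ^ k * toeplitzMinor a r c := by
  unfold toeplitzMinor
  have : (Matrix.of fun i j => seqZ (fun k => C * a k) ((r i : ℤ) - c j)) =
      C • Matrix.of fun i j => seqZ a ((r i : ℤ) - c j) := by
    ext i j
    simp [seqZ_const_mul]
  rw [this, Matrix.det_smul, Fintype.card_fin]

/-- PF sequences are closed under multiplication by a non-negative constant.
[Karlin 1968, Ch. 8, §1] [folklore] -/
theorem IsPolyaFrequencySeq.smul {a : ℕ → ℝ} (h : IsPolyaFrequencySeq a) {C : ℝ} (hC : 0 ≤ C) :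
    IsPolyaFrequencySeq (fun n => C * a n) := by
  intro k r c hr hc
  rw [toeplitzMinor_const_mul]
  exact mul_nonneg (pow_nonneg hC _) (h k r c hr hc)

/-! ### The unit sequence `(1, 0, 0, …)` -/

/-- `seqZ` of the unit sequence is the indicator of `0`. [folklore] -/
theorem seqZ_delta (n : ℤ) :
    seqZ (fun k => if k = 0 then (1 : ℝ) else 0) n = if n = 0 then 1 else 0 := by
  unfold seqZ
  by_cases hn : 0 ≤ n
  · obtain ⟨m, rfl⟩ := Int.eq_ofNat_of_zero_le hn
    simp
  · rw [if_neg hn, if_neg (by omega)]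

/-- The unit sequence `(1, 0, 0, …)` (generating function `1`) is PF: a minor of the identity
Toeplitz matrix is `1` if the row and column selections agree and `0` otherwise.
[Karlin 1968, Ch. 8, §1] [folklore] -/
theorem isPolyaFrequencySeq_delta : IsPolyaFrequencySeq (fun k => if k = 0 then (1 : ℝ) else 0) := by
  intro k r c hr hc
  unfold toeplitzMinor
  simp only [seqZ_delta]
  by_cases hrc : r = c
  · subst hrc
    have : (Matrix.of fun i j => if (r i : ℤ) - (r j : ℤ) = 0 then (1 : ℝ) else 0) = 1 := by
      ext i j
      simp only [Matrix.of_apply, sub_eq_zero, Nat.cast_inj, hr.injective.eq_iff, Matrix.one_apply]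
    rw [this, Matrix.det_one]
    exact zero_le_one
  · -- the least index where `r` and `c` differ gives a zero row or a zero column
    have hex : ∃ i, r i ≠ c i := by
      by_contra h
      push Not at h
      exact hrc (funext h)
    classical
    obtain ⟨i₀, hi₀, hmin⟩ : ∃ i₀, r i₀ ≠ c i₀ ∧ ∀ i, i < i₀ → r i = c i := by
      refine ⟨(Finset.univ.filter fun i => r i ≠ c i).min' ?_, ?_, ?_⟩
      · obtain ⟨i, hi⟩ := hex
        exact ⟨i, by simpa using hi⟩
      · have := Finset.min'_mem (Finset.univ.filter fun i => r i ≠ c i)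
          (by obtain ⟨i, hi⟩ := hex; exact ⟨i, by simpa using hi⟩)
        simpa using this
      · intro i hi
        by_contra hne
        have : (Finset.univ.filter fun i => r i ≠ c i).min' _ ≤ i :=
          Finset.min'_le _ _ (by simpa using hne)
        exact absurd hi (not_lt.2 this)
    apply le_of_eq
    symm
    rcases lt_or_gt_of_ne hi₀ with hlt | hgt
    · -- row `i₀` vanishes
      refine Matrix.det_eq_zero_of_row_eq_zero i₀ fun j => ?_
      simp only [Matrix.of_apply, sub_eq_zero, Nat.cast_inj, ite_eq_right_iff, one_ne_zero,
        imp_false]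
      intro h
      rcases lt_or_ge j i₀ with hj | hj
      · rw [← hmin j hj] at h
        exact absurd (hr hj) (by rw [h]; exact lt_irrefl _)
      · have : c i₀ ≤ c j := hc.monotone hj
        omega
    · -- column `i₀` vanishes
      refine Matrix.det_eq_zero_of_column_eq_zero i₀ fun i => ?_
      simp only [Matrix.of_apply, sub_eq_zero, Nat.cast_inj, ite_eq_right_iff, one_ne_zero,
        imp_false]
      intro h
      rcases lt_or_ge i i₀ with hi | hi
      · rw [hmin i hi] at h
        exact absurd (hc hi) (by rw [h]; exact lt_irrefl _)
      · have : r i₀ ≤ r i := hr.monotone hi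
        omega

/-! ### Multiplication of the generating function by `1 + α z` -/

/-- The coefficient sequence of `(1 + α z) · Σ aₙ zⁿ`: `b_n = a_n + α a_{n-1}` (`a_{-1} = 0`).
[Aissen–Schoenberg–Whitney 1952, §1] [folklore] -/
def mulLinear (a : ℕ → ℝ) (α : ℝ) (n : ℕ) : ℝ :=
  a n + α * seqZ a ((n : ℤ) - 1)

/-- `seqZ` of `mulLinear a α`. [folklore] -/
theorem seqZ_mulLinear (a : ℕ → ℝ) (α : ℝ) (n : ℤ) :
    seqZ (mulLinear a α) n = seqZ a n + α * seqZ a (n - 1) := by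
  by_cases hn : 0 ≤ n
  · obtain ⟨m, rfl⟩ := Int.eq_ofNat_of_zero_le hn
    rw [seqZ_natCast, seqZ_natCast, mulLinear]
  · rw [seqZ_of_neg _ (not_le.1 hn), seqZ_of_neg _ (not_le.1 hn), seqZ_of_neg _ (by omega)]
    ring

/-- `mulLinear` at `0`. [folklore] -/
@[simp] theorem mulLinear_zero (a : ℕ → ℝ) (α : ℝ) : mulLinear a α 0 = a 0 := by
  simp [mulLinear, seqZ_of_neg]

/-- `mulLinear` at successors. [folklore] -/
@[simp] theorem mulLinear_succ (a : ℕ → ℝ) (α : ℝ) (n : ℕ) :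
    mulLinear a α (n + 1) = a (n + 1) + α * a n := by
  simp [mulLinear]

/-- A Toeplitz "minor" with weakly increasing (possibly repeating) column indices of a PF sequence
is `≥ 0`: either the columns are strictly increasing, or two columns coincide. [folklore] -/
theorem toeplitzMinor_nonneg_of_monotone {a : ℕ → ℝ} (h : IsPolyaFrequencySeq a) {k : ℕ}
    (r c : Fin k → ℕ) (hr : StrictMono r) (hc : Monotone c) : 0 ≤ toeplitzMinor a r c := by
  by_cases hinj : Function.Injective c
  · exact h k r c hr (hc.strictMono_of_injective hinj)
  · unfold Function.Injective at hinj
    push Not at hinj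
    obtain ⟨i, j, hij, hne⟩ := hinj
    unfold toeplitzMinor
    rw [Matrix.det_zero_of_column_eq hne (fun l => by simp [hij])]

/-- **PF is preserved under multiplication of the generating function by `1 + α z`, `α ≥ 0`.**
Column-multilinear expansion of the minor of `b = mulLinear a α`: column `j` is column `c_j`
plus `α ×` column `c_j + 1` of the Toeplitz matrix of `a`. [Aissen–Schoenberg–Whitney 1952, §1;
Karlin 1968, Ch. 8, §3] [folklore] -/
theorem IsPolyaFrequencySeq.mulLinear {a : ℕ → ℝ} (h : IsPolyaFrequencySeq a) {α : ℝ}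
    (hα : 0 ≤ α) : IsPolyaFrequencySeq (mulLinear a α) := by
  classical
  intro k r c hr hc
  unfold toeplitzMinor
  -- pass to the transpose so that columns become the arguments of the multilinear map `det`
  set M : Matrix (Fin k) (Fin k) ℝ :=
    Matrix.of fun i j => seqZ (Literature.Analysis.TotalPositivity.mulLinear a α) ((r i : ℤ) - c j) with hMdef
  rw [← Matrix.det_transpose]
  -- column `j` as a sum over `e : Fin 2` of `g j e`
  set g : Fin k → Fin 2 → (Fin k → ℝ) := fun j e i =>
    if e = 0 then seqZ a ((r i : ℤ) - c j) else α * seqZ a ((r i : ℤ) - (c j + 1 : ℕ)) with hg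
  have hM : Matrix.transpose M = fun j => ∑ e : Fin 2, g j e := by
    ext j i
    simp only [hMdef, Matrix.transpose_apply, Matrix.of_apply, seqZ_mulLinear, hg,
      Fin.sum_univ_two, Fin.isValue, if_true, one_ne_zero, if_false, Finset.sum_apply]
    push_cast
    ring_nf
  rw [show Matrix.det (Matrix.transpose M) = Matrix.detRowAlternating (Matrix.transpose M)
      from rfl, hM]
  rw [show (Matrix.detRowAlternating : ((Fin k → ℝ) [⋀^Fin k]→ₗ[ℝ] ℝ)) (fun j => ∑ e : Fin 2, g j e)
      = (Matrix.detRowAlternating : ((Fin k → ℝ) [⋀^Fin k]→ₗ[ℝ] ℝ)).toMultilinearMap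
        (fun j => ∑ e : Fin 2, g j e) from rfl, MultilinearMap.map_sum]
  refine Finset.sum_nonneg fun ε _ => ?_
  -- each term: pull out the scalars `α^{[ε j = 1]}`
  set w : Fin k → ℝ := fun j => if ε j = 0 then 1 else α with hw
  set c' : Fin k → ℕ := fun j => if ε j = 0 then c j else c j + 1 with hc'
  have hterm : (fun j => g j (ε j)) = fun j => w j • fun i => seqZ a ((r i : ℤ) - c' j) := by
    funext j
    simp only [hg, hw, hc']
    split_ifs with hj <;> ext i <;> simp
  rw [hterm, MultilinearMap.map_smul_univ, smul_eq_mul]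
  refine mul_nonneg (Finset.prod_nonneg fun j _ => by simp only [hw]; split_ifs <;> simp [hα]) ?_
  -- the remaining determinant is a Toeplitz minor of `a` with weakly increasing columns `c'`
  have hdet : (Matrix.detRowAlternating : ((Fin k → ℝ) [⋀^Fin k]→ₗ[ℝ] ℝ)).toMultilinearMap
      (fun j => fun i => seqZ a ((r i : ℤ) - c' j)) = toeplitzMinor a r c' := by
    unfold toeplitzMinor
    rw [← Matrix.det_transpose]
    rfl
  rw [hdet]
  refine toeplitzMinor_nonneg_of_monotone h r c' hr fun i j hij => ?_
  simp only [hc']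
  rcases hij.lt_or_eq with hlt | rfl
  · have := hc hlt
    split_ifs <;> omega
  · exact le_rfl

/-! ### Coefficients of `C ∏ (1 + αᵢ X)` -/

/-- Coefficients of `p · (1 + α X)` are `mulLinear` of the coefficients of `p`. [folklore] -/
theorem coeff_mul_one_add_C_mul_X (p : ℝ[X]) (α : ℝ) (n : ℕ) :
    (p * (1 + Polynomial.C α * X)).coeff n = mulLinear (fun m => p.coeff m) α n := by
  rw [mul_add, mul_one, coeff_add, ← mul_assoc]
  cases n with
  | zero => simp [mulLinear, seqZ_of_neg]
  | succ n =>
    rw [Polynomial.coeff_mul_X, coeff_mul_C, mulLinear_succ, mul_comm]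

/-- **The coefficient sequence of `C ∏_{i<N} (1 + αᵢ X)` is PF** for `C ≥ 0`, `αᵢ ≥ 0`
(induction on `N` with `IsPolyaFrequencySeq.mulLinear`). [Aissen–Schoenberg–Whitney 1952, §1;
Karlin 1968, Ch. 8, §3] [folklore] -/
theorem isPolyaFrequencySeq_coeff_prod_linear {C : ℝ} (hC : 0 ≤ C) {α : ℕ → ℝ}
    (hα : ∀ i, 0 ≤ α i) (N : ℕ) :
    IsPolyaFrequencySeq fun n =>
      (Polynomial.C C * ∏ i ∈ Finset.range N, (1 + Polynomial.C (α i) * X)).coeff n := by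
  induction N with
  | zero =>
    simp only [Finset.range_zero, Finset.prod_empty, mul_one, coeff_C]
    have : (fun n : ℕ => if n = 0 then C else 0) = fun n => C * (if n = 0 then 1 else 0) := by
      funext n; split_ifs <;> simp
    rw [this]
    exact isPolyaFrequencySeq_delta.smul hC
  | succ N ih =>
    simp only [Finset.prod_range_succ, ← mul_assoc]
    simp only [coeff_mul_one_add_C_mul_X]
    exact ih.mulLinear (hα N)

/-! ### Termwise limits -/

/-- A Toeplitz minor depends continuously on the sequence (product topology). [folklore] -/
theorem continuous_toeplitzMinor {k : ℕ} (r c : Fin k → ℕ) :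
    Continuous fun a : ℕ → ℝ => toeplitzMinor a r c := by
  unfold toeplitzMinor
  refine Continuous.matrix_det ?_
  refine continuous_matrix fun i j => ?_
  simp only [Matrix.of_apply]
  unfold seqZ
  split_ifs
  · exact continuous_apply _
  · exact continuous_const

/-- **PF is closed under termwise limits**: if `a m → b` termwise and each `a m` is PF then `b` is
PF. [Karlin 1968, Ch. 8, §1; Aissen–Schoenberg–Whitney 1952, §1] [folklore] -/
theorem IsPolyaFrequencySeq.of_tendsto {ι : Type*} {l : Filter ι} [l.NeBot] {a : ι → ℕ → ℝ}
    {b : ℕ → ℝ} (h : ∀ m, IsPolyaFrequencySeq (a m))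
    (hlim : ∀ n, Tendsto (fun m => a m n) l (𝓝 (b n))) : IsPolyaFrequencySeq b := by
  intro k r c hr hc
  have hpi : Tendsto a l (𝓝 b) := tendsto_pi_nhds.2 hlim
  have := ((continuous_toeplitzMinor r c).tendsto b).comp hpi
  exact ge_of_tendsto' this fun m => h m k r c hr hc

end Literature.Analysis.TotalPositivity
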